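import Summits.QuantumFields.YangMills.Theorems.UnitScaleTiltProp7TwoWordStokes
import Summits.QuantumFields.YangMills.Theorems.UnitScaleTiltProp7FlatHolonomy
import Summits.QuantumFields.YangMills.Theorems.UnitScaleTiltProp7BlockLineCount
import Summits.QuantumFields.YangMills.Theorems.UnitScaleTiltProp7CovariantCoercivity
import Summits.QuantumFields.YangMills.Theorems.UnitScaleTiltProp7AxialGaugeFace
import Summits.QuantumFields.YangMills.Theorems.UnitScaleTiltProp8ChartHInvGeometry
import HarnessLib

/-!
# Route `UnitScaleTilt`, crux K1 «MinimiserStabilityRegPr» (stmt-QuantumFields-19200), route-R [RP] curved, the curved N6 row (R-C), transport geometry, Steps A–D knit —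
# THE PURE `LINE`-ITERATE VERSUS THE ENGINE'S COVARIANT STRAIGHT-LINE BLOCK FUNCTIONAL:
# `‖S_k(c) − ℓ^{−d}·Ad_{g_c}A^{U₀}_c Y‖ ≤ (2η_k + ((len_k + (2d+1)L^k)²/2)·δ)·ℓ^{−d}·Σ_{x∈B^k(c₋)}Σ_{t<L^k}‖Y(x + te_μ, μ)‖` and the `ℓ²` row
# `Σ_c‖…‖² ≤ (2η_k + …δ)²·(L^k)^{2−d}·Σ_b‖Y_b‖²` — with `g_c = U₀(comb from the k-centre to the k-corner)` ONE transport per coarse bond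

Cell `ym3-torus`, width seat `ym-ust-20520-w2` (g3).  The knit of this seat's transport-geometry letters (⧗ `…LineIterRepr.exists_lineIter_repr` representation; ✓ p610318
`…TwoWordStokes` perimeter Stokes; ✓ p609108 `…BlockLineCount` ℓ² count) with ★routeR-w2 g0's engine dictionary (the `holT∕unitsField ↔ holAt` letters `val_holT_unitsField`∕`holT_toUField`∕`holT_eq_holAt` of `B10Eq27TorusAxialLog`,
as in ✓ `…CovCombMeanFrames`; `Prop7AxialGaugeFace.netDisp_treeWord`) and ★p1's `val_embIter`.  `A^{U₀}_c` is LITERALLY the penalty summand of `Prop7CovariantCoercivity` ∕ the `hA` row of ✓ p601741 (generic `P`, `SU(N)`, level `k`).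
THEOREMS ONLY (0 `def`, 0 `sorry`); `--supports stmt-QuantumFields-19200`, count-neutral.  YM₃ on T³ is a ladder rung (R3), not the Clay problem; nothing here claims the curved N6
in full, S2, P, the crux or the gap.

WHAT IS PROVED (ns `…Theorems.Prop7LineIterVsEngine`).
* §1 `H_eq_halfPow` (the centre-offset recursion family is `(L^j−1)/2`, via ★p1's `ChartHInv.half_pow_succ_sub_one`), `l1_le_of_bound`, `walkEnd_embIter_cornerWord` (the comb `treeWord(−(L^k−1)/2·𝟙)` from the `k`-centre
  ends at the `k`-corner `fibreSite 0 k c₋ 0`), `conj_sub_conj_le_of_norm_sub_le` (`‖aXa* − bXb*‖ ≤ 2‖a − b‖‖X‖` for `‖a‖,‖b‖ ≤ 1`).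
* §2 `engine_term_su` — the engine's term `R(V(Γ_{ȳ,x_r})V([x_r → t]))Y` is `Ad` of `U₀(walk ȳ (treeWord r ++ t steps))` (one word from the corner).
* §3 ★★★ `norm_lineIter_sub_engine_le` (pointwise, per coarse bond) and ★★★ `sum_normSq_lineIter_sub_engine_le` (the `ℓ²` row), from any data `(Ω, τ, ρ, t, W)` satisfying the
  invariant (I1)–(I6) of `exists_lineIter_repr` with `H k = (L^k−1)/2`, under `PlaqSmall δ U₀`.
HONEST SCOPE.  With ✓ p606268∕p608741 this closes the `E`-part of `hA` for ✓ p601741 up to the per-level sizes `a_j`, `θ, η, len` (displayed recursions; geometric tower ⇒ O(ε));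
the `Σ_cE_c²` numerology against `c_E·ℓ⁵ε²` and the constraint value `Q k Y` (★routeR-w3's budget) are the S2′ knit's, not this file's.

References: T. Bałaban, CMP 99 (1985) 389–434 [Balaban1985BackgroundPropagators] (Thm 3.11 p.416); CMP 95 (1984) 17–40 [Balaban1984PropagatorsI] ((1.18) p.20); CMP 98 (1985)
17–51 [Balaban1985Averaging] ((19)–(20) p.21, (125) p.36).
-/

noncomputable section

open scoped BigOperators Matrix.Norms.L2Operator

namespace Summit.QuantumFields.YangMills.Theorems.Prop7LineIterVsEngine

open Literature.MathematicalPhysics.QuantumFieldTheory.Balaban1983to89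
open Finset T4Continuum T4ReflectionCone BlockAveraging B1RG242Torus
open BlockAveragingEMLLinearised (card_idx)
open B15DeterminingSets (embIter)
open B7Prop1Explicit (treeWord l1 length_treeWord disp_treeWord)
open B7Eq78Linearization (conjR conjR_apply)
open B10Eq27TorusAxialLog (holT unitsField toUField val_holT_unitsField holT_toUField val_suIncl holT_eq_holAt)
open Summit.QuantumFields.YangMills.Theorems.Prop7HolRatioPerStep (norm_coe_eq_one norm_star_coe_eq_one coe_star_mul_self)
open Summit.QuantumFields.YangMills.Theorems.Prop7FlatHolonomy (holAt_walk_append)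
open Summit.QuantumFields.YangMills.Theorems.Prop7AxialGaugeFace (netDisp_treeWord)
open Summit.QuantumFields.YangMills.Theorems.Prop7TwoWordStokes (norm_conj_holAt_sub_conj_holAt_le)
open Summit.QuantumFields.YangMills.Theorems.Prop7BlockLineCount (sum_normSq_le_of_blockLine_bound)
open Summit.QuantumFields.YangMills.Theorems.ChartHInv (val_embIter half_pow_succ_sub_one)

variable {P : Params} {N : ℕ}

/-! ## §1 Letters -/

/-- The centre-offset recursion family IS `(L^j − 1)/2`. [folklore] -/
theorem H_eq_halfPow (H : ℕ → ℕ) (hH0 : H 0 = 0) (hH : ∀ j, H (j + 1) = (P.L - 1) / 2 * P.L ^ j + H j) : ∀ j, H j = (P.L ^ j - 1) / 2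
  | 0 => by simp [hH0]
  | j + 1 => by rw [hH j, H_eq_halfPow H hH0 hH j, half_pow_succ_sub_one]

/-- `l1 v ≤ d·B` when every `|v ν| ≤ B`. [folklore] -/
theorem l1_le_of_bound {d : ℕ} (v : B7Prop1Explicit.Site d) {B : ℕ} (h : ∀ ν, (v ν).natAbs ≤ B) : l1 v ≤ d * B := by
  unfold l1
  calc ∑ κ, (v κ).natAbs ≤ ∑ _κ : Fin d, B := Finset.sum_le_sum fun κ _ => h κ
    _ = d * B := by rw [Finset.sum_const, Finset.card_univ, Fintype.card_fin, smul_eq_mul]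


/-- **THE COMB FROM THE `k`-CENTRE TO THE `k`-CORNER**: the tree word of displacement `−(L^k−1)/2` in every direction, spelled from `embIter k y`, ends at the corner
`fibreSite 0 k y 0` (standing range; `val_embIter`). [cite: Balaban1987RG1, (0.1) p.252] -/
theorem walkEnd_embIter_cornerWord {k : ℕ} (hk : k ≤ P.m + P.K) (y : Site P k) :
    walkEnd (embIter k y) (treeWord fun _ : Fin P.d => -(((P.L ^ k - 1) / 2 : ℕ) : ℤ))
      = Site.fibreSite 0 k y (fun _ => ⟨0, pow_pos P.L_pos k⟩) := by
  have walkEnd_treeWord' : ∀ (x : Site P 0) (v : Fin P.d → ℤ), walkEnd x (treeWord v) = fun ν => x ν + ((v ν : ℤ) : ZMod (P.sitesPerDir 0)) := by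
    intro x v; funext ν; rw [walkEnd_apply, netDisp_treeWord]
  rw [walkEnd_treeWord']
  funext ν
  have hv : ((embIter k y) ν) = ((((y ν).val * P.L ^ k + (P.L ^ k - 1) / 2 : ℕ)) : ZMod (P.sitesPerDir 0)) := by
    rw [← val_embIter k hk y ν, ZMod.natCast_zmod_val]
  rw [hv]
  simp only [Site.fibreSite, add_zero]
  set h : ℕ := (P.L ^ k - 1) / 2 with hh
  rw [Int.cast_neg, Int.cast_natCast]
  push_cast
  ring

/-- `‖aXa* − bXb*‖ ≤ 2‖a − b‖·‖X‖` for `‖a‖, ‖b‖ ≤ 1`. [folklore] -/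
theorem conj_sub_conj_le_of_norm_sub_le {n : Type*} [Fintype n] [DecidableEq n] {a b X : Matrix n n ℂ} (ha : ‖a‖ ≤ 1) (hb : ‖b‖ ≤ 1) :
    ‖a * X * star a - b * X * star b‖ ≤ 2 * ‖a - b‖ * ‖X‖ := by
  have e : a * X * star a - b * X * star b = (a - b) * X * star a + b * X * (star a - star b) := by noncomm_ring
  have hs : ‖star a - star b‖ = ‖a - b‖ := by rw [← star_sub, norm_star]
  have hsa : ‖star a‖ ≤ 1 := by rw [norm_star]; exact ha
  rw [e]
  calc _ ≤ ‖a - b‖ * ‖X‖ * ‖star a‖ + ‖b‖ * ‖X‖ * ‖star a - star b‖ :=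
        (norm_add_le _ _).trans (add_le_add ((norm_mul_le _ _).trans (mul_le_mul_of_nonneg_right (norm_mul_le _ _) (norm_nonneg _)))
          ((norm_mul_le _ _).trans (mul_le_mul_of_nonneg_right (norm_mul_le _ _) (norm_nonneg _))))
    _ ≤ ‖a - b‖ * ‖X‖ * 1 + 1 * ‖X‖ * ‖a - b‖ := by
        rw [hs]
        exact add_le_add (mul_le_mul_of_nonneg_left hsa (by positivity)) (mul_le_mul_of_nonneg_right (mul_le_mul_of_nonneg_right hb (norm_nonneg _)) (norm_nonneg _))
    _ = 2 * ‖a - b‖ * ‖X‖ := by ring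

/-! ## §2 The engine's term in `SU(N)` letters: one word from the corner -/

/-- **THE ENGINE'S ONE-STROKE TERM IS `Ad` OF ONE CORNER WORD**: `R(V(Γ_{ȳ,x_r})·V([x_r → t steps]))X = U₀(walk ȳ (treeWord r ++ t steps))·X·(…)*` with `ȳ` the `k`-corner and
`x_r = fibreSite 0 k c₋ r = walkEnd ȳ (treeWord r)`. [cite: Balaban1985Averaging, (9) p.19] -/
theorem engine_term_su [NeZero N] {k : ℕ} (U₀ : GaugeField P 0 (Matrix.specialUnitaryGroup (Fin N) ℂ))
    (c : PBond P k) (r : Fin P.d → Fin (P.L ^ k)) (t : ℕ) (X : Matrix (Fin N) (Fin N) ℂ) :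
    conjR (holT (unitsField (toUField U₀)) (Site.fibreSite 0 k c.src fun _ => ⟨0, pow_pos P.L_pos k⟩) (treeWord fun ν => ((r ν : ℕ) : ℤ))
          * holT (unitsField (toUField U₀)) (Site.fibreSite 0 k c.src r) (List.replicate t (c.dir, true))) X
      = ((holAt U₀ (walk (Site.fibreSite 0 k c.src fun _ => ⟨0, pow_pos P.L_pos k⟩) ((treeWord fun ν => ((r ν : ℕ) : ℤ)) ++ List.replicate t (c.dir, true))) :
            Matrix.specialUnitaryGroup (Fin N) ℂ) : Matrix (Fin N) (Fin N) ℂ) * X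
        * star ((holAt U₀ (walk (Site.fibreSite 0 k c.src fun _ => ⟨0, pow_pos P.L_pos k⟩) ((treeWord fun ν => ((r ν : ℕ) : ℤ)) ++ List.replicate t (c.dir, true))) :
            Matrix.specialUnitaryGroup (Fin N) ℂ) : Matrix (Fin N) (Fin N) ℂ) := by
  -- the `holT ∕ unitsField ↔ holAt` letters (as in ★routeR-w2's `Prop7CovCombMeanFrames.coe_holT_su`)
  have coe_holT_su' : ∀ (x : Site P 0) (w : List (Letter P.d)),
      ((holT (unitsField (toUField U₀)) x w : (Matrix (Fin N) (Fin N) ℂ)ˣ) : Matrix (Fin N) (Fin N) ℂ)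
        = ((holAt U₀ (walk x w) : Matrix.specialUnitaryGroup (Fin N) ℂ) : Matrix (Fin N) (Fin N) ℂ) := by
    intro x w; rw [val_holT_unitsField, holT_toUField, val_suIncl, holT_eq_holAt]
  have coe_inv_holT_su' : ∀ (x : Site P 0) (w : List (Letter P.d)),
      (((holT (unitsField (toUField U₀)) x w)⁻¹ : (Matrix (Fin N) (Fin N) ℂ)ˣ) : Matrix (Fin N) (Fin N) ℂ)
        = star ((holAt U₀ (walk x w) : Matrix.specialUnitaryGroup (Fin N) ℂ) : Matrix (Fin N) (Fin N) ℂ) := by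
    intro x w; rw [Matrix.coe_units_inv, coe_holT_su', Matrix.inv_eq_left_inv (coe_star_mul_self _)]
  have walkEnd_treeWord' : ∀ (x : Site P 0) (v : Fin P.d → ℤ), walkEnd x (treeWord v) = fun ν => x ν + ((v ν : ℤ) : ZMod (P.sitesPerDir 0)) := by
    intro x v; funext ν; rw [walkEnd_apply, netDisp_treeWord]
  -- the comb from the corner ends at `x_r`
  have hend : walkEnd (Site.fibreSite 0 k c.src fun _ => (⟨0, pow_pos P.L_pos k⟩ : Fin (P.L ^ k))) (treeWord fun ν => ((r ν : ℕ) : ℤ))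
      = Site.fibreSite 0 k c.src r := by
    rw [walkEnd_treeWord']
    funext ν
    simp only [Site.fibreSite, add_zero]
    push_cast
    ring
  rw [holAt_walk_append, hend, conjR_apply, Units.val_mul, mul_inv_rev, Units.val_mul, coe_holT_su', coe_holT_su', coe_inv_holT_su', coe_inv_holT_su',
    Submonoid.coe_mul, star_mul]

/-! ## §3 ★★★ The pure `LINE`-iterate versus the engine functional -/

section Main

variable {n : ℕ} [NeZero n]

/-- ★★★ **POINTWISE**: for data `(Ω, τ, ρ, t, W)` satisfying the invariant (I1)–(I6) of `exists_lineIter_repr` at level `k ≤ m + K` with `H k = (L^k−1)/2`, and `PlaqSmall δ U₀`,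
for every `k`-bond `c`: `‖S k c − (L^k)^{−d}·(g_c·A^{U₀}_cY·g_c*)‖ ≤ (2η + ((Λ + (2d+1)L^k)²/2)·δ)·(L^k)^{−d}·Σ_rΣ_{t<L^k}‖Y⟨shift^t(fibreSite 0 k c₋ r), μ_c⟩‖`, where
`g_c = U₀(walk (embIter k c₋) (treeWord(−(L^k−1)/2·𝟙)))`, `η` bounds the transport errors and `Λ` the word lengths. [cite: Balaban1985BackgroundPropagators, Thm 3.11 p.416] -/
theorem norm_lineIter_sub_engine_le {k : ℕ} (hk : k ≤ P.m + P.K) (U₀ : GaugeField P 0 (Matrix.specialUnitaryGroup (Fin n) ℂ)) (Y : PBond P 0 → Matrix (Fin n) (Fin n) ℂ)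
    {δ : ℝ} (hδ : 0 ≤ δ) (hU : PlaqSmall δ U₀) (Sk : PBond P k → Matrix (Fin n) (Fin n) ℂ)
    {Ω : Type} [Fintype Ω] (τ : PBond P k → Ω → Matrix.specialUnitaryGroup (Fin n) ℂ) (ρ : PBond P k → Ω → (Fin P.d → Fin (P.L ^ k)))
    (t : PBond P k → Ω → ℕ) (W : PBond P k → Ω → List (Letter P.d)) {η : ℝ} (hη : 0 ≤ η) {Λ : ℕ}
    (h1 : ∀ c : PBond P k, Sk c = (((Fintype.card (Idx P) : ℂ)) ^ k)⁻¹ • ∑ ω, ((τ c ω : Matrix.specialUnitaryGroup (Fin n) ℂ) : Matrix (Fin n) (Fin n) ℂ)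
        * Y ⟨(fun z : Site P 0 => z.shift c.dir)^[t c ω] (Site.fibreSite 0 k c.src (ρ c ω)), c.dir⟩ * star ((τ c ω : Matrix.specialUnitaryGroup (Fin n) ℂ) : Matrix (Fin n) (Fin n) ℂ))
    (h2 : ∀ c ω, t c ω < P.L ^ k)
    (h3 : ∀ c ω, ‖((τ c ω : Matrix.specialUnitaryGroup (Fin n) ℂ) : Matrix (Fin n) (Fin n) ℂ)
        - ((holAt U₀ (walk (embIter k c.src) (W c ω)) : Matrix.specialUnitaryGroup (Fin n) ℂ) : Matrix (Fin n) (Fin n) ℂ)‖ ≤ η)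
    (h4 : ∀ c ω, (W c ω).length ≤ Λ)
    (h5 : ∀ c ω (ν : Fin P.d), netDisp (W c ω) ν = ((ρ c ω ν : ℕ) : ℤ) - (((P.L ^ k - 1) / 2 : ℕ) : ℤ) + (if ν = c.dir then ((t c ω : ℕ) : ℤ) else 0))
    (h6 : ∀ (M : Type) [AddCommMonoid M] (c : PBond P k) (F : (Fin P.d → Fin (P.L ^ k)) → ℕ → M),
        ∑ ω, F (ρ c ω) (t c ω) = ((Fintype.card (Equiv.Perm (Fin P.d)) ^ 2) ^ k) • ∑ r : Fin P.d → Fin (P.L ^ k), ∑ s ∈ Finset.range (P.L ^ k), F r s)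
    (c : PBond P k) :
    ‖Sk c - (((P.L : ℂ) ^ k) ^ P.d)⁻¹ •
        (((holAt U₀ (walk (embIter k c.src) (treeWord fun _ : Fin P.d => -(((P.L ^ k - 1) / 2 : ℕ) : ℤ))) : Matrix.specialUnitaryGroup (Fin n) ℂ) : Matrix (Fin n) (Fin n) ℂ)
          * (∑ r : Fin P.d → Fin (P.L ^ k), ∑ s ∈ Finset.range (P.L ^ k),
              conjR (holT (unitsField (toUField U₀)) (Site.fibreSite 0 k c.src fun _ => ⟨0, pow_pos P.L_pos k⟩) (treeWord fun ν => ((r ν : ℕ) : ℤ))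
                  * holT (unitsField (toUField U₀)) (Site.fibreSite 0 k c.src r) (List.replicate s (c.dir, true)))
                (Y ⟨(fun z : Site P 0 => z.shift c.dir)^[s] (Site.fibreSite 0 k c.src r), c.dir⟩))
          * star (((holAt U₀ (walk (embIter k c.src) (treeWord fun _ : Fin P.d => -(((P.L ^ k - 1) / 2 : ℕ) : ℤ))) : Matrix.specialUnitaryGroup (Fin n) ℂ) :
              Matrix (Fin n) (Fin n) ℂ)))‖
      ≤ (2 * η + ((((Λ + (2 * P.d + 1) * P.L ^ k : ℕ) : ℝ)) ^ 2 / 2) * δ) * ((((P.L : ℝ) ^ k) ^ P.d)⁻¹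
          * ∑ r : Fin P.d → Fin (P.L ^ k), ∑ s ∈ Finset.range (P.L ^ k), ‖Y ⟨(fun z : Site P 0 => z.shift c.dir)^[s] (Site.fibreSite 0 k c.src r), c.dir⟩‖) := by
  -- letters
  set y₀ : Site P 0 := embIter k c.src with hy₀
  set γ : List (Letter P.d) := treeWord fun _ : Fin P.d => -(((P.L ^ k - 1) / 2 : ℕ) : ℤ) with hγ
  set g : Matrix (Fin n) (Fin n) ℂ := ((holAt U₀ (walk y₀ γ) : Matrix.specialUnitaryGroup (Fin n) ℂ) : Matrix (Fin n) (Fin n) ℂ) with hg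
  -- the reference word from the centre for the one-stroke term `(r, s)`
  set cw : (Fin P.d → Fin (P.L ^ k)) → ℕ → List (Letter P.d) := fun r s => (treeWord fun ν => ((r ν : ℕ) : ℤ)) ++ List.replicate s (c.dir, true) with hcw
  set refT : (Fin P.d → Fin (P.L ^ k)) → ℕ → Matrix (Fin n) (Fin n) ℂ := fun r s =>
    ((holAt U₀ (walk y₀ (γ ++ cw r s)) : Matrix.specialUnitaryGroup (Fin n) ℂ) : Matrix (Fin n) (Fin n) ℂ) with hrefT
  set bd : (Fin P.d → Fin (P.L ^ k)) → ℕ → PBond P 0 := fun r s => ⟨(fun z : Site P 0 => z.shift c.dir)^[s] (Site.fibreSite 0 k c.src r), c.dir⟩ with hbd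
  -- (a) the engine functional, conjugated by `g`, is the reference-word family over the one-stroke index
  have hcorner : walkEnd y₀ γ = Site.fibreSite 0 k c.src (fun _ => ⟨0, pow_pos P.L_pos k⟩) := walkEnd_embIter_cornerWord hk c.src
  have hrefT' : ∀ r s, refT r s = g * ((holAt U₀ (walk (Site.fibreSite 0 k c.src fun _ => ⟨0, pow_pos P.L_pos k⟩) (cw r s)) : Matrix.specialUnitaryGroup (Fin n) ℂ) :
      Matrix (Fin n) (Fin n) ℂ) := by
    intro r s
    rw [hrefT, hg]
    simp only []
    rw [holAt_walk_append, hcorner, Submonoid.coe_mul]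
  have hterm : ∀ r s, g * conjR (holT (unitsField (toUField U₀)) (Site.fibreSite 0 k c.src fun _ => ⟨0, pow_pos P.L_pos k⟩) (treeWord fun ν => ((r ν : ℕ) : ℤ))
          * holT (unitsField (toUField U₀)) (Site.fibreSite 0 k c.src r) (List.replicate s (c.dir, true))) (Y (bd r s)) * star g
        = refT r s * Y (bd r s) * star (refT r s) := by
    intro r s
    rw [engine_term_su, hrefT' r s, star_mul]
    simp only [hcw]
    noncomm_ring
  -- the scalar identity `((L^k)^d)⁻¹ = (|I|^k)⁻¹·((d!)²)^k`
  have hscal : ((((P.L : ℂ) ^ k) ^ P.d)⁻¹) = ((((Fintype.card (Idx P) : ℂ)) ^ k)⁻¹) * ((((Fintype.card (Equiv.Perm (Fin P.d)) ^ 2) ^ k : ℕ) : ℂ)) := by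
    have hS : ((Fintype.card (Equiv.Perm (Fin P.d)) : ℂ)) ≠ 0 := Nat.cast_ne_zero.mpr Fintype.card_pos.ne'
    have e1 : ((Fintype.card (Idx P) : ℂ)) = (P.L : ℂ) ^ P.d * ((Fintype.card (Equiv.Perm (Fin P.d)) : ℂ)) ^ 2 := by
      rw [card_idx, Nat.cast_mul, Nat.cast_pow, Nat.cast_pow]
    have e2 : ((((Fintype.card (Equiv.Perm (Fin P.d)) ^ 2) ^ k : ℕ) : ℂ)) = (((Fintype.card (Equiv.Perm (Fin P.d)) : ℂ)) ^ 2) ^ k := by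
      rw [Nat.cast_pow, Nat.cast_pow]
    rw [e1, e2, mul_pow, mul_inv, mul_assoc, inv_mul_cancel₀ (pow_ne_zero _ (pow_ne_zero _ hS)), mul_one, ← pow_mul, ← pow_mul, mul_comm]
  have hengine : (((P.L : ℂ) ^ k) ^ P.d)⁻¹ • (g * (∑ r : Fin P.d → Fin (P.L ^ k), ∑ s ∈ Finset.range (P.L ^ k),
          conjR (holT (unitsField (toUField U₀)) (Site.fibreSite 0 k c.src fun _ => ⟨0, pow_pos P.L_pos k⟩) (treeWord fun ν => ((r ν : ℕ) : ℤ))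
              * holT (unitsField (toUField U₀)) (Site.fibreSite 0 k c.src r) (List.replicate s (c.dir, true))) (Y (bd r s))) * star g)
      = (((Fintype.card (Idx P) : ℂ)) ^ k)⁻¹ • ∑ ω, refT (ρ c ω) (t c ω) * Y (bd (ρ c ω) (t c ω)) * star (refT (ρ c ω) (t c ω)) := by
    rw [h6 (Matrix (Fin n) (Fin n) ℂ) c (fun r s => refT r s * Y (bd r s) * star (refT r s)), ← Nat.cast_smul_eq_nsmul ℂ, smul_smul, ← hscal,
      Finset.mul_sum, Finset.sum_mul]
    congr 1
    refine Finset.sum_congr rfl fun r _ => ?_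
    rw [Finset.mul_sum, Finset.sum_mul]
    exact Finset.sum_congr rfl fun s _ => hterm r s
  -- (b) termwise comparison
  have hcard : (0 : ℝ) < (Fintype.card (Idx P) : ℝ) := by exact_mod_cast Fintype.card_pos
  have hpt : ∀ ω, ‖((τ c ω : Matrix.specialUnitaryGroup (Fin n) ℂ) : Matrix (Fin n) (Fin n) ℂ) * Y (bd (ρ c ω) (t c ω)) * star ((τ c ω : Matrix.specialUnitaryGroup (Fin n) ℂ) : Matrix (Fin n) (Fin n) ℂ)
        - refT (ρ c ω) (t c ω) * Y (bd (ρ c ω) (t c ω)) * star (refT (ρ c ω) (t c ω))‖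
      ≤ (2 * η + ((((Λ + (2 * P.d + 1) * P.L ^ k : ℕ) : ℝ)) ^ 2 / 2) * δ) * ‖Y (bd (ρ c ω) (t c ω))‖ := by
    intro ω
    set X := Y (bd (ρ c ω) (t c ω)) with hX
    set hW : Matrix (Fin n) (Fin n) ℂ := ((holAt U₀ (walk y₀ (W c ω)) : Matrix.specialUnitaryGroup (Fin n) ℂ) : Matrix (Fin n) (Fin n) ℂ) with hhW
    -- τ versus the holonomy of its word
    have hA : ‖((τ c ω : Matrix.specialUnitaryGroup (Fin n) ℂ) : Matrix (Fin n) (Fin n) ℂ) * X * star ((τ c ω : Matrix.specialUnitaryGroup (Fin n) ℂ) : Matrix (Fin n) (Fin n) ℂ)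
          - hW * X * star hW‖ ≤ 2 * η * ‖X‖ := by
      refine (conj_sub_conj_le_of_norm_sub_le (norm_coe_eq_one _).le (by rw [hhW]; exact (norm_coe_eq_one _).le)).trans ?_
      exact mul_le_mul_of_nonneg_right (mul_le_mul_of_nonneg_left (h3 c ω) (by norm_num)) (norm_nonneg _)
    -- the word versus the reference word: same net displacement, perimeter Stokes
    have hnet : ∀ ν, netDisp (W c ω) ν = netDisp (γ ++ cw (ρ c ω) (t c ω)) ν := by
      intro ν
      rw [h5, hγ, hcw, netDisp_append, netDisp_append, netDisp_treeWord, netDisp_treeWord, netDisp_replicate]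
      by_cases hν : ν = c.dir
      · subst hν; simp
        ring
      · rw [if_neg hν, if_neg (Ne.symm hν)]; push_cast; ring
    have hlen : (W c ω).length + (γ ++ cw (ρ c ω) (t c ω)).length ≤ Λ + (2 * P.d + 1) * P.L ^ k := by
      have hW4 := h4 c ω
      have hγl : γ.length ≤ P.d * P.L ^ k := by
        rw [hγ, length_treeWord]
        refine (l1_le_of_bound _ (B := P.L ^ k) fun ν => ?_).trans le_rfl
        simp only [Int.natAbs_neg, Int.natAbs_natCast]; omega
      have hcwl : (cw (ρ c ω) (t c ω)).length ≤ (P.d + 1) * P.L ^ k := by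
        rw [hcw]
        simp only [List.length_append, List.length_replicate, length_treeWord]
        have hl1 : l1 (fun ν => ((ρ c ω ν : ℕ) : ℤ)) ≤ P.d * P.L ^ k :=
          l1_le_of_bound _ (B := P.L ^ k) fun ν => by simp only [Int.natAbs_natCast]; exact (ρ c ω ν).isLt.le
        have ht := h2 c ω
        nlinarith
      rw [List.length_append]
      nlinarith
    have hB : ‖hW * X * star hW - refT (ρ c ω) (t c ω) * X * star (refT (ρ c ω) (t c ω))‖
        ≤ ((((Λ + (2 * P.d + 1) * P.L ^ k : ℕ) : ℝ)) ^ 2 / 2) * δ * ‖X‖ := by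
      have h := norm_conj_holAt_sub_conj_holAt_le U₀ hδ hU y₀ (W c ω) (γ ++ cw (ρ c ω) (t c ω)) hnet X
      rw [hhW, hrefT]
      refine h.trans (mul_le_mul_of_nonneg_right (mul_le_mul_of_nonneg_right ?_ hδ) (norm_nonneg _))
      have hcast : ((((W c ω).length + (γ ++ cw (ρ c ω) (t c ω)).length : ℕ) : ℝ)) ≤ (((Λ + (2 * P.d + 1) * P.L ^ k : ℕ) : ℝ)) := by exact_mod_cast hlen
      have h0 : (0 : ℝ) ≤ ((((W c ω).length + (γ ++ cw (ρ c ω) (t c ω)).length : ℕ) : ℝ)) := Nat.cast_nonneg _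
      nlinarith
    calc _ ≤ ‖((τ c ω : Matrix.specialUnitaryGroup (Fin n) ℂ) : Matrix (Fin n) (Fin n) ℂ) * X * star ((τ c ω : Matrix.specialUnitaryGroup (Fin n) ℂ) : Matrix (Fin n) (Fin n) ℂ)
            - hW * X * star hW‖ + ‖hW * X * star hW - refT (ρ c ω) (t c ω) * X * star (refT (ρ c ω) (t c ω))‖ := norm_sub_le_norm_sub_add_norm_sub _ _ _
      _ ≤ 2 * η * ‖X‖ + ((((Λ + (2 * P.d + 1) * P.L ^ k : ℕ) : ℝ)) ^ 2 / 2) * δ * ‖X‖ := add_le_add hA hB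
      _ = _ := by ring
  -- (c) assemble: both sides are `|I|^{−k}`-weighted families over `Ω`; the weights `|I|^{−k}·(d!)^{2k} = (L^k)^{−d}`
  rw [h1 c, hengine, ← smul_sub, ← Finset.sum_sub_distrib, norm_smul, norm_inv, norm_pow, Complex.norm_natCast]
  have hsum : ∑ ω, ‖((τ c ω : Matrix.specialUnitaryGroup (Fin n) ℂ) : Matrix (Fin n) (Fin n) ℂ) * Y (bd (ρ c ω) (t c ω)) * star ((τ c ω : Matrix.specialUnitaryGroup (Fin n) ℂ) : Matrix (Fin n) (Fin n) ℂ)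
        - refT (ρ c ω) (t c ω) * Y (bd (ρ c ω) (t c ω)) * star (refT (ρ c ω) (t c ω))‖
      ≤ (2 * η + ((((Λ + (2 * P.d + 1) * P.L ^ k : ℕ) : ℝ)) ^ 2 / 2) * δ) * ∑ ω, ‖Y (bd (ρ c ω) (t c ω))‖ := by
    rw [Finset.mul_sum]; exact Finset.sum_le_sum fun ω _ => hpt ω
  have hmass : ∑ ω, ‖Y (bd (ρ c ω) (t c ω))‖ = ((Fintype.card (Equiv.Perm (Fin P.d)) ^ 2) ^ k : ℕ) * ∑ r : Fin P.d → Fin (P.L ^ k), ∑ s ∈ Finset.range (P.L ^ k), ‖Y (bd r s)‖ := by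
    rw [h6 ℝ c (fun r s => ‖Y (bd r s)‖), nsmul_eq_mul]
  have hC0 : 0 ≤ 2 * η + ((((Λ + (2 * P.d + 1) * P.L ^ k : ℕ) : ℝ)) ^ 2 / 2) * δ := by positivity
  have hscalR : ((((Fintype.card (Idx P) : ℝ)) ^ k)⁻¹) * ((((Fintype.card (Equiv.Perm (Fin P.d)) ^ 2) ^ k : ℕ) : ℝ)) = ((((P.L : ℝ) ^ k) ^ P.d)⁻¹) := by
    have hS : ((Fintype.card (Equiv.Perm (Fin P.d)) : ℝ)) ≠ 0 := Nat.cast_ne_zero.mpr Fintype.card_pos.ne'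
    have e1 : ((Fintype.card (Idx P) : ℝ)) = (P.L : ℝ) ^ P.d * ((Fintype.card (Equiv.Perm (Fin P.d)) : ℝ)) ^ 2 := by
      rw [card_idx, Nat.cast_mul, Nat.cast_pow, Nat.cast_pow]
    have e2 : ((((Fintype.card (Equiv.Perm (Fin P.d)) ^ 2) ^ k : ℕ) : ℝ)) = (((Fintype.card (Equiv.Perm (Fin P.d)) : ℝ)) ^ 2) ^ k := by
      rw [Nat.cast_pow, Nat.cast_pow]
    rw [e1, e2, mul_pow, mul_inv, mul_assoc, inv_mul_cancel₀ (pow_ne_zero _ (pow_ne_zero _ hS)), mul_one, ← pow_mul, ← pow_mul, mul_comm]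
  calc ((Fintype.card (Idx P) : ℝ) ^ k)⁻¹ * ‖∑ ω, (((τ c ω : Matrix.specialUnitaryGroup (Fin n) ℂ) : Matrix (Fin n) (Fin n) ℂ) * Y (bd (ρ c ω) (t c ω))
            * star ((τ c ω : Matrix.specialUnitaryGroup (Fin n) ℂ) : Matrix (Fin n) (Fin n) ℂ) - refT (ρ c ω) (t c ω) * Y (bd (ρ c ω) (t c ω)) * star (refT (ρ c ω) (t c ω)))‖
      ≤ ((Fintype.card (Idx P) : ℝ) ^ k)⁻¹ * ((2 * η + ((((Λ + (2 * P.d + 1) * P.L ^ k : ℕ) : ℝ)) ^ 2 / 2) * δ) * ∑ ω, ‖Y (bd (ρ c ω) (t c ω))‖) :=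
        mul_le_mul_of_nonneg_left ((norm_sum_le _ _).trans hsum) (by positivity)
    _ = (2 * η + ((((Λ + (2 * P.d + 1) * P.L ^ k : ℕ) : ℝ)) ^ 2 / 2) * δ) * ((((P.L : ℝ) ^ k) ^ P.d)⁻¹
          * ∑ r : Fin P.d → Fin (P.L ^ k), ∑ s ∈ Finset.range (P.L ^ k), ‖Y (bd r s)‖) := by
        rw [hmass, ← hscalR]
        ring

/-- ★★★ **THE `ℓ²` ROW**: under the same hypotheses, `Σ_c‖S k c − (L^k)^{−d}·Ad_{g_c}A^{U₀}_cY‖² ≤ ((2η + ((Λ + (2d+1)L^k)²/2)δ)·(L^k)^{−d})²·((L^k)^d·L^k)·L^k·Σ_b‖Y_b‖²`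
(= `(2η + …δ)²·(L^k)^{2−d}·Σ‖Y‖²`; Step D ✓ p609108 `sum_normSq_le_of_blockLine_bound`). [cite: Balaban1985BackgroundPropagators, Thm 3.11 p.416] -/
theorem sum_normSq_lineIter_sub_engine_le {k : ℕ} (hk : k ≤ P.m + P.K) (U₀ : GaugeField P 0 (Matrix.specialUnitaryGroup (Fin n) ℂ)) (Y : PBond P 0 → Matrix (Fin n) (Fin n) ℂ)
    {δ : ℝ} (hδ : 0 ≤ δ) (hU : PlaqSmall δ U₀) (Sk : PBond P k → Matrix (Fin n) (Fin n) ℂ)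
    {Ω : Type} [Fintype Ω] (τ : PBond P k → Ω → Matrix.specialUnitaryGroup (Fin n) ℂ) (ρ : PBond P k → Ω → (Fin P.d → Fin (P.L ^ k)))
    (t : PBond P k → Ω → ℕ) (W : PBond P k → Ω → List (Letter P.d)) {η : ℝ} (hη : 0 ≤ η) {Λ : ℕ}
    (h1 : ∀ c : PBond P k, Sk c = (((Fintype.card (Idx P) : ℂ)) ^ k)⁻¹ • ∑ ω, ((τ c ω : Matrix.specialUnitaryGroup (Fin n) ℂ) : Matrix (Fin n) (Fin n) ℂ)
        * Y ⟨(fun z : Site P 0 => z.shift c.dir)^[t c ω] (Site.fibreSite 0 k c.src (ρ c ω)), c.dir⟩ * star ((τ c ω : Matrix.specialUnitaryGroup (Fin n) ℂ) : Matrix (Fin n) (Fin n) ℂ))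
    (h2 : ∀ c ω, t c ω < P.L ^ k)
    (h3 : ∀ c ω, ‖((τ c ω : Matrix.specialUnitaryGroup (Fin n) ℂ) : Matrix (Fin n) (Fin n) ℂ)
        - ((holAt U₀ (walk (embIter k c.src) (W c ω)) : Matrix.specialUnitaryGroup (Fin n) ℂ) : Matrix (Fin n) (Fin n) ℂ)‖ ≤ η)
    (h4 : ∀ c ω, (W c ω).length ≤ Λ)
    (h5 : ∀ c ω (ν : Fin P.d), netDisp (W c ω) ν = ((ρ c ω ν : ℕ) : ℤ) - (((P.L ^ k - 1) / 2 : ℕ) : ℤ) + (if ν = c.dir then ((t c ω : ℕ) : ℤ) else 0))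
    (h6 : ∀ (M : Type) [AddCommMonoid M] (c : PBond P k) (F : (Fin P.d → Fin (P.L ^ k)) → ℕ → M),
        ∑ ω, F (ρ c ω) (t c ω) = ((Fintype.card (Equiv.Perm (Fin P.d)) ^ 2) ^ k) • ∑ r : Fin P.d → Fin (P.L ^ k), ∑ s ∈ Finset.range (P.L ^ k), F r s) :
    ∑ c : PBond P k, ‖Sk c - (((P.L : ℂ) ^ k) ^ P.d)⁻¹ •
        (((holAt U₀ (walk (embIter k c.src) (treeWord fun _ : Fin P.d => -(((P.L ^ k - 1) / 2 : ℕ) : ℤ))) : Matrix.specialUnitaryGroup (Fin n) ℂ) : Matrix (Fin n) (Fin n) ℂ)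
          * (∑ r : Fin P.d → Fin (P.L ^ k), ∑ s ∈ Finset.range (P.L ^ k),
              conjR (holT (unitsField (toUField U₀)) (Site.fibreSite 0 k c.src fun _ => ⟨0, pow_pos P.L_pos k⟩) (treeWord fun ν => ((r ν : ℕ) : ℤ))
                  * holT (unitsField (toUField U₀)) (Site.fibreSite 0 k c.src r) (List.replicate s (c.dir, true)))
                (Y ⟨(fun z : Site P 0 => z.shift c.dir)^[s] (Site.fibreSite 0 k c.src r), c.dir⟩))
          * star (((holAt U₀ (walk (embIter k c.src) (treeWord fun _ : Fin P.d => -(((P.L ^ k - 1) / 2 : ℕ) : ℤ))) : Matrix.specialUnitaryGroup (Fin n) ℂ) :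
              Matrix (Fin n) (Fin n) ℂ)))‖ ^ 2
      ≤ ((2 * η + ((((Λ + (2 * P.d + 1) * P.L ^ k : ℕ) : ℝ)) ^ 2 / 2) * δ) * (((P.L : ℝ) ^ k) ^ P.d)⁻¹) ^ 2
          * ((((P.L : ℝ) ^ k) ^ P.d * (P.L : ℝ) ^ k) * (P.L : ℝ) ^ k) * ∑ b : PBond P 0, ‖Y b‖ ^ 2 := by
  have h0k : P.sitesPerDir 0 = P.L ^ k * P.sitesPerDir k := Prop7FlatCoercivity.sitesPerDir_zero_eq_pow_mul hk
  have hF := fun c : PBond P k => norm_lineIter_sub_engine_le hk U₀ Y hδ hU Sk τ ρ t W hη h1 h2 h3 h4 h5 h6 c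
  simp only [← mul_assoc] at hF
  exact sum_normSq_le_of_blockLine_bound h0k
    (F := fun c : PBond P k => Sk c - (((P.L : ℂ) ^ k) ^ P.d)⁻¹ •
        (((holAt U₀ (walk (embIter k c.src) (treeWord fun _ : Fin P.d => -(((P.L ^ k - 1) / 2 : ℕ) : ℤ))) : Matrix.specialUnitaryGroup (Fin n) ℂ) : Matrix (Fin n) (Fin n) ℂ)
          * (∑ r : Fin P.d → Fin (P.L ^ k), ∑ s ∈ Finset.range (P.L ^ k),
              conjR (holT (unitsField (toUField U₀)) (Site.fibreSite 0 k c.src fun _ => ⟨0, pow_pos P.L_pos k⟩) (treeWord fun ν => ((r ν : ℕ) : ℤ))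
                  * holT (unitsField (toUField U₀)) (Site.fibreSite 0 k c.src r) (List.replicate s (c.dir, true)))
                (Y ⟨(fun z : Site P 0 => z.shift c.dir)^[s] (Site.fibreSite 0 k c.src r), c.dir⟩))
          * star (((holAt U₀ (walk (embIter k c.src) (treeWord fun _ : Fin P.d => -(((P.L ^ k - 1) / 2 : ℕ) : ℤ))) : Matrix.specialUnitaryGroup (Fin n) ℂ) :
              Matrix (Fin n) (Fin n) ℂ))))
    Y hF

end Main

end Summit.QuantumFields.YangMills.Theorems.Prop7LineIterVsEngine

end
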